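import Literature.AlgebraicGeometry.Resolution.WeightedCentreFaceGraded
import HarnessLib

/-!
# Weighted centres — pure terms are read off the honest face ((KL iii) for the restriction tower)

Instrument for engine 1's `W(f)` TOY MODEL (cell `pub-rosobs`, LF-MODEL-eng1-g45 §6.2 (KL iii) / REDUCTION: "ρ(X) has a pure `σ^p` `W`-term — then so has `X`"), NOT a resolution
theorem and NOT about the invariant of [AbramovichTemkinWlodarczyk2024].

Killing the `Z`-variables does not change constant coefficients (`coeff_zero_killCompl`), so the pure coefficient of `σ^s` in slot `j ∉ Z` of an isotropy `A` equals that of its image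
under the tower storey `restrictFace` in the face slot `j` (`coeff_zero_restrictFace_C_X`; in the tree's `pureCoeff` notation, `pureCoeff_restrictFace`).  This is what pulls the
pure `σ^p`-term produced by THEOREM F on the core face back to the original isotropy in the REDUCTION.

References: [AbramovichTemkinWlodarczyk2024, §5.1 (p. 1575), Thm. 5.3.1 (2)–(3) (p. 1578)]; [Lang2002, Ch. IV §1].
-/

namespace Literature.AlgebraicGeometry.Resolution.WeightedBlowup

open Polynomial

section KillCompl

variable {k : Type*} [CommRing k] {ι κ : Type*} {f : κ → ι} (hf : Function.Injective f)

/-- **Killing variables keeps the constant coefficient** (bookkeeping). [cite: Lang2002, Ch. IV §1] -/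
theorem coeff_zero_killCompl (P : MvPolynomial ι k) : MvPolynomial.coeff 0 (_root_.MvPolynomial.killCompl hf P) = MvPolynomial.coeff 0 P := by
  classical
  induction P using MvPolynomial.induction_on with
  | C a => simp only [MvPolynomial.algHom_C, MvPolynomial.algebraMap_eq, MvPolynomial.coeff_zero_C]
  | add P Q hP hQ => simp only [map_add, MvPolynomial.coeff_add, hP, hQ]
  | mul_X P i hP =>
    rw [map_mul, ← MvPolynomial.constantCoeff_eq, ← MvPolynomial.constantCoeff_eq, map_mul, map_mul, MvPolynomial.constantCoeff_X, mul_zero]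
    by_cases hi : i ∈ Set.range f
    · obtain ⟨b, rfl⟩ := hi
      rw [Literature.AlgebraicGeometry.Resolution.MvPolynomial.killCompl_X_apply, MvPolynomial.constantCoeff_X, mul_zero]
    · rw [Literature.AlgebraicGeometry.Resolution.MvPolynomial.killCompl_X_of_not_mem_range _ hi, map_zero, mul_zero]

end KillCompl

namespace ZKernel

variable {k : Type*} [CommRing k] {ι : Type*} {w : ι → ℚ} {Z V : Set ι} {g : MvPolynomial ι k}

/-- **(KL iii) Pure terms are read off the face**: the constant (pure) coefficient of `σ^s` in `A (C ε_j)`, `j ∉ Z`, equals that of `(restrictFace A) (C ε_j)` on the honest face ring.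
Instrument for engine 1's `W(f)` toy model, NOT a resolution theorem. [cite: AbramovichTemkinWlodarczyk2024, §5.1 (p. 1575), Thm. 5.3.1 (2)–(3) (p. 1578)] -/
theorem coeff_zero_restrictFace_C_X (A : isoFix w Z V g) (j : {j : ι // j ∉ Z}) (s : ℕ) :
    MvPolynomial.coeff 0 ((restrictFace w Z V g A (C (MvPolynomial.X j))).coeff s) =
      MvPolynomial.coeff 0 (((A : (MvPolynomial ι k)[X] ≃+* (MvPolynomial ι k)[X]) (C (MvPolynomial.X j.1))).coeff s) := by
  rw [restrictFace_C_X, faceRingEquiv_mk, Polynomial.coeff_map, AlgHom.toRingHom_eq_coe, AlgHom.coe_toRingHom, coeff_zero_killCompl]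

/-- The same in the tree's `pureCoeff` notation: `pureCoeff (restrictFace A) j s = pureCoeff A j.1 s` — a pure `σ^s`-term of the face image in a face slot IS a pure `σ^s`-term of `A`
in that slot (LF-MODEL §6.2 REDUCTION: THEOREM F's pure `σ^p` `W`-term on the core pulls back along the tower).  [cite: AbramovichTemkinWlodarczyk2024, Thm. 5.3.1 (2)–(3) (p. 1578)] -/
theorem pureCoeff_restrictFace (A : isoFix w Z V g) (j : {j : ι // j ∉ Z}) (s : ℕ) :
    pureCoeff (restrictFace w Z V g A : (MvPolynomial {j : ι // j ∉ Z} k)[X] ≃+* (MvPolynomial {j : ι // j ∉ Z} k)[X]).toRingHom j s =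
      pureCoeff (A : (MvPolynomial ι k)[X] ≃+* (MvPolynomial ι k)[X]).toRingHom j.1 s := by
  rw [pureCoeff, pureCoeff, RingEquiv.toRingHom_eq_coe, RingHom.coe_coe, RingEquiv.toRingHom_eq_coe, RingHom.coe_coe]
  exact coeff_zero_restrictFace_C_X A j s

end ZKernel

end Literature.AlgebraicGeometry.Resolution.WeightedBlowup
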